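import Literature.NumberTheory.Automorphic.HeckeTransversalGL
import Literature.NumberTheory.Automorphic.ParabolicGLBigCell
import HarnessLib

/-!
# The Bruhat decomposition of `GL_n` over a field

Topic `NumberTheory/Automorphic`. For a field `K` and `n : ℕ` every invertible matrix is a
product `g = b · w · u` of an invertible upper triangular matrix `b`, a permutation matrix `w`
and an upper unitriangular matrix `u`:

* `exists_upperUnitriangular_mul_mul_eq_diagonal_mul_permMatrix` — **row reduction inside the
  Borel**: there are upper unitriangular `u₁, u₂` with `u₁ g u₂ = diag(d) · P_σ` a monomial
  matrix (`d i ≠ 0`, `P_σ = σ.permMatrix K`, `(P_σ)_{ij} = [σ i = j]`);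
* `exists_eq_borel_mul_permGL_mul_upperUnitriangular` — **Bruhat decomposition**
  `GL_n(K) = ⋃_σ B P_σ U` (`B = standardParabolicGL K id`, `U = upperUnitriangular (Fin n) K`,
  `permGL σ` the permutation matrix of `HeckeTransversalGL`);
* `exists_eq_parabolic_mul_permGL_mul_upperUnitriangular` — hence `GL_n(K) = ⋃_σ P_c P_σ U` for
  every standard parabolic `P_c` of a monotone block labelling `c` (`B ≤ P_c`,
  `borel_le_standardParabolicGL` of `ParabolicGLBigCell`).

This is Goldfeld, *Automorphic forms and L-functions for the group GL(n, ℝ)* (2006),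
Proposition 10.3.2, `GL(n) = B_n W_n B_n` (stated there over `ℝ`; the printed proof — Gaussian
elimination by row and column operations *inside the Borel subgroup* — works verbatim over any
field and is the one formalised here), i.e. the Bruhat decomposition of a group with a `BN`-pair
(Malle–Testerman 2011, Theorem 11.17) for `GL_n`. Uniqueness of `σ` (disjointness of the double
cosets) is not treated here.

## Proof (Goldfeld 2006, proof of Prop. 10.3.2)

Induction on the rows from the bottom (`IsMonomialFrom g r p`: the rows of index `≥ r` are
already monomial — row `i` has its only non-zero entry in the column `p i`, and that column has
no other non-zero entry). To treat the row `r`, let `j₀` be the *first* column with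
`g r j₀ ≠ 0` (the row is non-zero as `det g ≠ 0`); subtracting `g r k / g r j₀` times the column
`j₀` from the columns `k > j₀` is right multiplication by the upper unitriangular
`colShearMatrix j₀ c` and clears the row `r` off `j₀`; then subtracting `g i j₀ / g r j₀` times
the row `r` from the rows `i < r` is left multiplication by the upper unitriangular
`rowShearMatrix r d` and clears the column `j₀` above `r`. The rows below `r` and their pivot
columns are untouched (`isMonomialFrom_step`). After `n` steps `u₁ g u₂` is monomial, i.e.
`diag(d) P_σ` (`exists_isMonomialFrom`), and `g = (u₁⁻¹ diag d) P_σ u₂⁻¹`.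

All declarations are definitions with bodies (the two shear matrices, the bookkeeping predicate)
or proved theorems; no named fact, no `sorry`.

## References

* D. Goldfeld, *Automorphic Forms and L-Functions for the Group GL(n, ℝ)*, Cambridge Studies in
  Advanced Mathematics 99, CUP (2006), §10.3, Proposition 10.3.2, p. 292 (held; PDF p. 221).
  [Goldfeld2006]
* G. Malle, D. Testerman, *Linear Algebraic Groups and Finite Groups of Lie Type*, Cambridge
  Studies in Advanced Mathematics 133, CUP (2011), Theorem 11.17, p. 92 (held; PDF p. 93).
  [MalleTesterman2011]
-/

namespace Literature.NumberTheory.Automorphic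

open Matrix

section Field

variable {K : Type*} [Field K] {n : ℕ}

/-! ### Two families of upper unitriangular elementary matrices -/

/-- The **row shear** `1 + ∑_{i < r} d_i E_{i r}`: left multiplication by it adds `d i` times the
row `r` to each row `i < r`. [folklore] -/
def rowShearMatrix (r : Fin n) (d : Fin n → K) : Matrix (Fin n) (Fin n) K :=
  1 + Matrix.of fun i l => if l = r ∧ i < r then d i else 0

/-- The **column shear** `1 + ∑_{k > j₀} c_k E_{j₀ k}`: right multiplication by it adds `c k`
times the column `j₀` to each column `k > j₀`. [folklore] -/
def colShearMatrix (j₀ : Fin n) (c : Fin n → K) : Matrix (Fin n) (Fin n) K :=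
  1 + Matrix.of fun l k => if l = j₀ ∧ j₀ < k then c k else 0

/-- Entries of `rowShearMatrix r d * g`: the row `i < r` becomes `row i + d i • row r`, the other
rows are unchanged. [folklore] -/
theorem rowShearMatrix_mul_apply (r : Fin n) (d : Fin n → K) (g : Matrix (Fin n) (Fin n) K)
    (i k : Fin n) :
    (rowShearMatrix r d * g) i k = g i k + if i < r then d i * g r k else 0 := by
  rw [rowShearMatrix, Matrix.add_mul, Matrix.one_mul, Matrix.add_apply, Matrix.mul_apply]
  congr 1
  rw [Finset.sum_eq_single r]
  · simp only [Matrix.of_apply, true_and]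
    split_ifs <;> simp
  · intro l _ hl
    simp [Matrix.of_apply, hl]
  · intro h
    exact absurd (Finset.mem_univ r) h

/-- Entries of `g * colShearMatrix j₀ c`: the column `k > j₀` becomes `col k + c k • col j₀`, the
other columns are unchanged. [folklore] -/
theorem mul_colShearMatrix_apply (j₀ : Fin n) (c : Fin n → K) (g : Matrix (Fin n) (Fin n) K)
    (i k : Fin n) :
    (g * colShearMatrix j₀ c) i k = g i k + if j₀ < k then g i j₀ * c k else 0 := by
  rw [colShearMatrix, Matrix.mul_add, Matrix.mul_one, Matrix.add_apply, Matrix.mul_apply]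
  congr 1
  rw [Finset.sum_eq_single j₀]
  · simp only [Matrix.of_apply, true_and]
    split_ifs <;> simp
  · intro l _ hl
    simp [Matrix.of_apply, hl]
  · intro h
    exact absurd (Finset.mem_univ j₀) h

/-- `rowShearMatrix r d` is upper triangular. [folklore] -/
theorem blockTriangular_rowShearMatrix (r : Fin n) (d : Fin n → K) :
    (rowShearMatrix r d).BlockTriangular id := by
  intro i l hli
  have hne : i ≠ l := fun h => by simp [h] at hli
  simp only [rowShearMatrix, Matrix.add_apply, Matrix.one_apply_ne hne, Matrix.of_apply, zero_add,
    ite_eq_right_iff, and_imp]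
  rintro rfl hir
  exact absurd (lt_trans hir hli) (lt_irrefl _)

/-- `colShearMatrix j₀ c` is upper triangular. [folklore] -/
theorem blockTriangular_colShearMatrix (j₀ : Fin n) (c : Fin n → K) :
    (colShearMatrix j₀ c).BlockTriangular id := by
  intro l k hkl
  have hne : l ≠ k := fun h => by simp [h] at hkl
  simp only [colShearMatrix, Matrix.add_apply, Matrix.one_apply_ne hne, Matrix.of_apply, zero_add,
    ite_eq_right_iff, and_imp]
  rintro rfl hk
  exact absurd (lt_trans hk hkl) (lt_irrefl _)

/-- The diagonal of `rowShearMatrix r d` is `1`. [folklore] -/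
theorem rowShearMatrix_apply_self (r : Fin n) (d : Fin n → K) (i : Fin n) :
    rowShearMatrix r d i i = 1 := by
  simp only [rowShearMatrix, Matrix.add_apply, Matrix.one_apply_eq, Matrix.of_apply,
    add_eq_left, ite_eq_right_iff, and_imp]
  rintro rfl h
  exact absurd h (lt_irrefl _)

/-- The diagonal of `colShearMatrix j₀ c` is `1`. [folklore] -/
theorem colShearMatrix_apply_self (j₀ : Fin n) (c : Fin n → K) (k : Fin n) :
    colShearMatrix j₀ c k k = 1 := by
  simp only [colShearMatrix, Matrix.add_apply, Matrix.one_apply_eq, Matrix.of_apply,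
    add_eq_left, ite_eq_right_iff, and_imp]
  rintro rfl h
  exact absurd h (lt_irrefl _)

/-- `det (rowShearMatrix r d) = 1`. [folklore] -/
theorem det_rowShearMatrix (r : Fin n) (d : Fin n → K) : (rowShearMatrix r d).det = 1 := by
  rw [Matrix.det_of_upperTriangular (blockTriangular_rowShearMatrix r d)]
  exact Finset.prod_eq_one fun i _ => rowShearMatrix_apply_self r d i

/-- `det (colShearMatrix j₀ c) = 1`. [folklore] -/
theorem det_colShearMatrix (j₀ : Fin n) (c : Fin n → K) : (colShearMatrix j₀ c).det = 1 := by
  rw [Matrix.det_of_upperTriangular (blockTriangular_colShearMatrix j₀ c)]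
  exact Finset.prod_eq_one fun k _ => colShearMatrix_apply_self j₀ c k

/-- The row shear as an element of the upper unitriangular group `U_n(K)`. [folklore] -/
noncomputable def rowShear (r : Fin n) (d : Fin n → K) : ↥(upperUnitriangular (Fin n) K) :=
  ⟨Matrix.GeneralLinearGroup.mkOfDetNeZero (rowShearMatrix r d)
      (by rw [det_rowShearMatrix]; exact one_ne_zero),
    (mem_upperUnitriangular_iff _).2
      ⟨blockTriangular_rowShearMatrix r d, rowShearMatrix_apply_self r d⟩⟩

/-- The column shear as an element of the upper unitriangular group `U_n(K)`. [folklore] -/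
noncomputable def colShear (j₀ : Fin n) (c : Fin n → K) : ↥(upperUnitriangular (Fin n) K) :=
  ⟨Matrix.GeneralLinearGroup.mkOfDetNeZero (colShearMatrix j₀ c)
      (by rw [det_colShearMatrix]; exact one_ne_zero),
    (mem_upperUnitriangular_iff _).2
      ⟨blockTriangular_colShearMatrix j₀ c, colShearMatrix_apply_self j₀ c⟩⟩

/-- The matrix of `rowShear r d`. [folklore] -/
@[simp] theorem coe_rowShear (r : Fin n) (d : Fin n → K) :
    (((rowShear r d : ↥(upperUnitriangular (Fin n) K)) : GL (Fin n) K) : Matrix (Fin n) (Fin n) K) =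
      rowShearMatrix r d := rfl

/-- The matrix of `colShear j₀ c`. [folklore] -/
@[simp] theorem coe_colShear (j₀ : Fin n) (c : Fin n → K) :
    (((colShear j₀ c : ↥(upperUnitriangular (Fin n) K)) : GL (Fin n) K) : Matrix (Fin n) (Fin n) K) =
      colShearMatrix j₀ c := rfl

/-! ### The bookkeeping predicate: the bottom rows are monomial -/

/-- `IsMonomialFrom g r p`: the rows of index `≥ r` of `g` are **monomial with pivots `p`** — for
`r ≤ i`, the entry `g i (p i)` is non-zero, it is the only non-zero entry of the row `i`, and the
only non-zero entry of the column `p i`. [folklore] -/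
structure IsMonomialFrom (g : Matrix (Fin n) (Fin n) K) (r : ℕ) (p : Fin n → Fin n) : Prop where
  /-- the pivot entries are non-zero -/
  apply_ne_zero : ∀ i : Fin n, r ≤ (i : ℕ) → g i (p i) ≠ 0
  /-- the row `i ≥ r` vanishes off its pivot -/
  apply_eq_zero_of_ne : ∀ i : Fin n, r ≤ (i : ℕ) → ∀ k : Fin n, k ≠ p i → g i k = 0
  /-- the pivot column of the row `i ≥ r` vanishes off the row `i` -/
  apply_eq_zero_of_ne' : ∀ i : Fin n, r ≤ (i : ℕ) → ∀ i' : Fin n, i' ≠ i → g i' (p i) = 0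

/-- The predicate is vacuous from row `n` on. [folklore] -/
theorem isMonomialFrom_of_le (g : Matrix (Fin n) (Fin n) K) {r : ℕ} (hr : n ≤ r) (p : Fin n → Fin n) :
    IsMonomialFrom g r p :=
  ⟨fun i hi => absurd (lt_of_lt_of_le i.is_lt (hr.trans hi)) (lt_irrefl _),
    fun i hi => absurd (lt_of_lt_of_le i.is_lt (hr.trans hi)) (lt_irrefl _),
    fun i hi => absurd (lt_of_lt_of_le i.is_lt (hr.trans hi)) (lt_irrefl _)⟩

/-- Pivots of distinct monomial rows are distinct. [folklore] -/
theorem IsMonomialFrom.apply_ne_apply {g : Matrix (Fin n) (Fin n) K} {r : ℕ} {p : Fin n → Fin n}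
    (h : IsMonomialFrom g r p) {i i' : Fin n} (hi : r ≤ (i : ℕ)) (hi' : r ≤ (i' : ℕ)) (hne : i ≠ i') :
    p i ≠ p i' := by
  intro hp
  have h0 := h.apply_eq_zero_of_ne' i' hi' i hne
  rw [← hp] at h0
  exact h.apply_ne_zero i hi h0

/-- **The elimination step.** If the rows `> r` of an invertible `g` are monomial, then for
suitable shears the rows `≥ r` of `rowShearMatrix r d * (g * colShearMatrix j₀ c)` are monomial,
with the old pivots and the new pivot `j₀` (the first non-zero column of the row `r`) in the
row `r`. [folklore] -/
theorem isMonomialFrom_step {g : Matrix (Fin n) (Fin n) K} (hg : g.det ≠ 0) (r : Fin n)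
    {p : Fin n → Fin n} (hp : IsMonomialFrom g ((r : ℕ) + 1) p) :
    ∃ (d c : Fin n → K) (j₀ : Fin n),
      IsMonomialFrom (rowShearMatrix r d * (g * colShearMatrix j₀ c)) r (Function.update p r j₀) := by
  classical
  -- the first non-zero column `j₀` of the row `r`
  set S : Finset (Fin n) := Finset.univ.filter fun k => g r k ≠ 0 with hS_def
  have hS : S.Nonempty := by
    by_contra hS
    rw [Finset.not_nonempty_iff_eq_empty] at hS
    apply hg
    refine Matrix.det_eq_zero_of_row_eq_zero r fun k => ?_
    by_contra hk
    have : k ∈ S := Finset.mem_filter.2 ⟨Finset.mem_univ _, hk⟩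
    rw [hS] at this
    exact absurd this (Finset.notMem_empty _)
  set j₀ : Fin n := S.min' hS with hj₀_def
  have hj₀ : g r j₀ ≠ 0 := (Finset.mem_filter.1 (Finset.min'_mem S hS)).2
  have hmin : ∀ k : Fin n, k < j₀ → g r k = 0 := by
    intro k hk
    by_contra h
    exact absurd (Finset.min'_le S k (Finset.mem_filter.2 ⟨Finset.mem_univ _, h⟩)) (not_le.2 hk)
  -- the old pivots avoid `j₀`, and the column `j₀` vanishes below `r`
  have hlt : ∀ i : Fin n, (r : ℕ) + 1 ≤ (i : ℕ) → r ≠ i := by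
    intro i hi h
    rw [h] at hi
    exact absurd hi (by omega)
  have hpj : ∀ i : Fin n, (r : ℕ) + 1 ≤ (i : ℕ) → p i ≠ j₀ := by
    intro i hi h
    have := hp.apply_eq_zero_of_ne' i hi r (hlt i hi)
    rw [h] at this
    exact hj₀ this
  have hcol : ∀ i : Fin n, (r : ℕ) + 1 ≤ (i : ℕ) → g i j₀ = 0 :=
    fun i hi => hp.apply_eq_zero_of_ne i hi j₀ (hpj i hi).symm
  -- the shears
  set c : Fin n → K := fun k => -(g r k / g r j₀) with hc_def
  set d : Fin n → K := fun i => -(g i j₀ / g r j₀) with hd_def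
  set g₁ := g * colShearMatrix j₀ c with hg₁_def
  set g₂ := rowShearMatrix r d * g₁ with hg₂_def
  have hg₁ : ∀ i k, g₁ i k = g i k + if j₀ < k then g i j₀ * c k else 0 :=
    fun i k => mul_colShearMatrix_apply j₀ c g i k
  have hg₂ : ∀ i k, g₂ i k = g₁ i k + if i < r then d i * g₁ r k else 0 :=
    fun i k => rowShearMatrix_mul_apply r d g₁ i k
  -- the row `r` of `g₁` is `g r j₀ • e_{j₀}`
  have hrow : ∀ k, g₁ r k = if k = j₀ then g r j₀ else 0 := by
    intro k
    rw [hg₁]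
    rcases lt_trichotomy k j₀ with hk | rfl | hk
    · rw [if_neg (not_lt.2 hk.le), if_neg hk.ne, hmin k hk, add_zero]
    · rw [if_neg (lt_irrefl _), if_pos rfl, add_zero]
    · rw [if_pos hk, if_neg hk.ne', hc_def]
      show g r k + g r j₀ * -(g r k / g r j₀) = 0
      rw [mul_neg, mul_div_cancel₀ _ hj₀, add_neg_cancel]
  -- the rows below `r` are unchanged in `g₁`
  have hlow : ∀ i : Fin n, (r : ℕ) + 1 ≤ (i : ℕ) → ∀ k, g₁ i k = g i k := by
    intro i hi k
    rw [hg₁, hcol i hi, zero_mul, ite_self, add_zero]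
  -- the old pivot columns are unchanged in `g₁`
  have hpiv : ∀ i' : Fin n, (r : ℕ) + 1 ≤ (i' : ℕ) → ∀ i, g₁ i (p i') = g i (p i') := by
    intro i' hi' i
    rw [hg₁]
    have : c (p i') = 0 := by
      rw [hc_def]
      simp [hp.apply_eq_zero_of_ne' i' hi' r (hlt i' hi')]
    rw [this, mul_zero, ite_self, add_zero]
  -- entries of `g₂`
  have hg₂_low : ∀ i : Fin n, (r : ℕ) ≤ (i : ℕ) → ∀ k, g₂ i k = g₁ i k := by
    intro i hi k
    rw [hg₂, if_neg (not_lt.2 (Fin.le_def.2 hi)), add_zero]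
  have hg₂_up_j₀ : ∀ i : Fin n, i < r → g₂ i j₀ = 0 := by
    intro i hi
    rw [hg₂, if_pos hi, hrow, if_pos rfl, hg₁, if_neg (lt_irrefl _), add_zero, hd_def]
    show g i j₀ + -(g i j₀ / g r j₀) * g r j₀ = 0
    rw [neg_mul, div_mul_cancel₀ _ hj₀, add_neg_cancel]
  have hg₂_up : ∀ i : Fin n, i < r → ∀ k, k ≠ j₀ → g₂ i k = g₁ i k := by
    intro i hi k hk
    rw [hg₂, if_pos hi, hrow, if_neg hk, mul_zero, add_zero]
  refine ⟨d, c, j₀, ?_⟩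
  change IsMonomialFrom g₂ r (Function.update p r j₀)
  refine ⟨?_, ?_, ?_⟩
  · -- pivots are non-zero
    intro i hi
    rcases (Fin.le_def.2 hi : r ≤ i).eq_or_lt with h | h
    · subst h
      rw [Function.update_self, hg₂_low r le_rfl, hrow, if_pos rfl]
      exact hj₀
    · have hi' : (r : ℕ) + 1 ≤ (i : ℕ) := Fin.lt_def.1 h
      rw [Function.update_of_ne h.ne', hg₂_low i hi, hpiv i hi' i]
      exact hp.apply_ne_zero i hi'
  · -- rows vanish off their pivots
    intro i hi k hk
    rcases (Fin.le_def.2 hi : r ≤ i).eq_or_lt with h | h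
    · subst h
      rw [Function.update_self] at hk
      rw [hg₂_low r le_rfl, hrow, if_neg hk]
    · have hi' : (r : ℕ) + 1 ≤ (i : ℕ) := Fin.lt_def.1 h
      rw [Function.update_of_ne h.ne'] at hk
      rw [hg₂_low i hi, hlow i hi']
      exact hp.apply_eq_zero_of_ne i hi' k hk
  · -- pivot columns vanish off their rows
    intro i hi i' hi'i
    rcases (Fin.le_def.2 hi : r ≤ i).eq_or_lt with h | h
    · subst h
      rw [Function.update_self]
      rcases lt_or_gt_of_ne hi'i with h' | h'
      · exact hg₂_up_j₀ i' h'
      · have hi'' : (r : ℕ) + 1 ≤ (i' : ℕ) := Fin.lt_def.1 h'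
        rw [hg₂_low i' (Fin.le_def.1 h'.le), hlow i' hi'']
        exact hcol i' hi''
    · have hii : (r : ℕ) + 1 ≤ (i : ℕ) := Fin.lt_def.1 h
      rw [Function.update_of_ne h.ne']
      rcases lt_trichotomy i' r with h' | h' | h'
      · rw [hg₂_up i' h' (p i) (hpj i hii), hpiv i hii i']
        exact hp.apply_eq_zero_of_ne' i hii i' hi'i
      · rw [h', hg₂_low r le_rfl, hrow, if_neg (hpj i hii)]
      · rw [hg₂_low i' (Fin.le_def.1 h'.le), hpiv i hii i']
        exact hp.apply_eq_zero_of_ne' i hii i' hi'i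

/-- **Row reduction inside the Borel**: for every `m ≤ n` there are upper unitriangular `u₁, u₂`
such that the last `m` rows of `u₁ g u₂` are monomial. [folklore] -/
theorem exists_isMonomialFrom (g : GL (Fin n) K) (m : ℕ) (hm : m ≤ n) :
    ∃ (u₁ u₂ : ↥(upperUnitriangular (Fin n) K)) (p : Fin n → Fin n),
      IsMonomialFrom
        (((u₁ : GL (Fin n) K) * g * (u₂ : GL (Fin n) K) : GL (Fin n) K) : Matrix (Fin n) (Fin n) K)
        (n - m) p := by
  induction m with
  | zero =>
    exact ⟨1, 1, id, isMonomialFrom_of_le _ (by omega) _⟩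
  | succ m ih =>
    obtain ⟨u₁, u₂, p, hp⟩ := ih (Nat.le_of_succ_le hm)
    set r : Fin n := ⟨n - (m + 1), by omega⟩ with hr
    have hr1 : (r : ℕ) + 1 = n - m := by
      show n - (m + 1) + 1 = n - m
      omega
    rw [← hr1] at hp
    have hdet : ((((u₁ : GL (Fin n) K) * g * (u₂ : GL (Fin n) K) : GL (Fin n) K)) :
        Matrix (Fin n) (Fin n) K).det ≠ 0 :=
      (Matrix.isUnits_det_units _).ne_zero
    obtain ⟨d, c, j₀, h⟩ := isMonomialFrom_step hdet r hp
    refine ⟨rowShear r d * u₁, u₂ * colShear j₀ c, Function.update p r j₀, ?_⟩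
    have : (((rowShear r d * u₁ : ↥(upperUnitriangular (Fin n) K)) : GL (Fin n) K) * g *
        ((u₂ * colShear j₀ c : ↥(upperUnitriangular (Fin n) K)) : GL (Fin n) K) : GL (Fin n) K) =
        ((rowShear r d : ↥(upperUnitriangular (Fin n) K)) : GL (Fin n) K) *
          (((u₁ : GL (Fin n) K) * g * (u₂ : GL (Fin n) K)) *
            ((colShear j₀ c : ↥(upperUnitriangular (Fin n) K)) : GL (Fin n) K)) := by
      simp only [Subgroup.coe_mul, mul_assoc]
    rw [this, Units.val_mul, Units.val_mul, coe_rowShear, coe_colShear]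
    exact h

/-- **Monomial form.** For every `g ∈ GL_n(K)` there are upper unitriangular `u₁, u₂`, a
permutation `σ` and non-zero scalars `d i` with `u₁ g u₂ = diag(d) · P_σ`, where
`(P_σ)_{ij} = [σ i = j]` is Mathlib's `σ.permMatrix K`. (Gaussian elimination inside the Borel
subgroup: Goldfeld 2006, proof of Prop. 10.3.2.) [cite: Goldfeld2006, Prop. 10.3.2 (p. 292), proof] -/
theorem exists_upperUnitriangular_mul_mul_eq_diagonal_mul_permMatrix (g : GL (Fin n) K) :
    ∃ (u₁ u₂ : ↥(upperUnitriangular (Fin n) K)) (d : Fin n → K) (σ : Equiv.Perm (Fin n)),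
      (∀ i, d i ≠ 0) ∧
      ((((u₁ : GL (Fin n) K) * g * (u₂ : GL (Fin n) K) : GL (Fin n) K)) : Matrix (Fin n) (Fin n) K) =
        Matrix.diagonal d * σ.permMatrix K := by
  classical
  obtain ⟨u₁, u₂, p, hp⟩ := exists_isMonomialFrom g n le_rfl
  rw [Nat.sub_self] at hp
  set g' := ((((u₁ : GL (Fin n) K) * g * (u₂ : GL (Fin n) K) : GL (Fin n) K)) :
    Matrix (Fin n) (Fin n) K) with hg'
  have hinj : Function.Injective p := fun i i' h => by
    by_contra hne
    exact hp.apply_ne_apply (Nat.zero_le _) (Nat.zero_le _) hne h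
  let σ : Equiv.Perm (Fin n) := Equiv.ofBijective p hinj.bijective_of_finite
  refine ⟨u₁, u₂, fun i => g' i (p i), σ, fun i => hp.apply_ne_zero i (Nat.zero_le _), ?_⟩
  ext i k
  rw [Matrix.diagonal_mul, permMatrix_apply']
  change g' i k = g' i (p i) * if p i = k then 1 else 0
  by_cases h : p i = k
  · rw [if_pos h, mul_one, h]
  · rw [if_neg h, mul_zero]
    exact hp.apply_eq_zero_of_ne i (Nat.zero_le _) k (Ne.symm h)

/-- **The Bruhat decomposition of `GL_n(K)`**: every `g ∈ GL_n(K)` is `g = b · P_σ · u` with `b`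
invertible upper triangular (`standardParabolicGL K id`), `P_σ = permGL σ` a permutation matrix
and `u` upper unitriangular; i.e. `GL_n(K) = ⋃_{σ ∈ 𝔖_n} B P_σ B` (Goldfeld 2006, Prop. 10.3.2,
`GL(n, ℝ) = B_n W_n B_n`, same proof over any field; the Bruhat decomposition of a `BN`-pair,
Malle–Testerman 2011, Thm. 11.17). [cite: Goldfeld2006, Prop. 10.3.2 (p. 292)] -/
theorem exists_eq_borel_mul_permGL_mul_upperUnitriangular (g : GL (Fin n) K) :
    ∃ (b : GL (Fin n) K) (σ : Equiv.Perm (Fin n)) (u : ↥(upperUnitriangular (Fin n) K)),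
      b ∈ standardParabolicGL K (id : Fin n → Fin n) ∧ g = b * permGL σ * (u : GL (Fin n) K) := by
  classical
  obtain ⟨u₁, u₂, d, σ, hd, h⟩ := exists_upperUnitriangular_mul_mul_eq_diagonal_mul_permMatrix g
  have hdet : (Matrix.diagonal d).det ≠ 0 := by
    rw [Matrix.det_diagonal]
    exact Finset.prod_ne_zero_iff.2 fun i _ => hd i
  set D : GL (Fin n) K := Matrix.GeneralLinearGroup.mkOfDetNeZero (Matrix.diagonal d) hdet with hD
  have hDmem : D ∈ standardParabolicGL K (id : Fin n → Fin n) := by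
    change (Matrix.diagonal d).BlockTriangular id
    exact Matrix.blockTriangular_diagonal d
  have hGL : (u₁ : GL (Fin n) K) * g * (u₂ : GL (Fin n) K) = D * permGL σ := by
    refine Units.ext ?_
    rw [h, Units.val_mul, coe_permGL]
    rfl
  have hU : upperUnitriangular (Fin n) K ≤ standardParabolicGL K (id : Fin n → Fin n) :=
    unipotentRadicalGL_le K (id : Fin n → Fin n)
  refine ⟨((u₁⁻¹ : ↥(upperUnitriangular (Fin n) K)) : GL (Fin n) K) * D, σ, u₂⁻¹, ?_, ?_⟩
  · exact Subgroup.mul_mem _ (hU (u₁⁻¹).2) hDmem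
  · rw [Subgroup.coe_inv, Subgroup.coe_inv]
    calc g = (u₁ : GL (Fin n) K)⁻¹ * ((u₁ : GL (Fin n) K) * g * (u₂ : GL (Fin n) K)) *
        (u₂ : GL (Fin n) K)⁻¹ := by group
      _ = _ := by rw [hGL]; group

/-- **Relative Bruhat decomposition**: for a monotone block labelling `c` (so that `B ≤ P_c`),
every `g ∈ GL_n(K)` is `g = p · P_σ · u` with `p ∈ P_c`, `P_σ` a permutation matrix and `u` upper
unitriangular; i.e. `GL_n(K) = ⋃_σ P_c P_σ U_n` (from Goldfeld 2006, Prop. 10.3.2, and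
`B ≤ P_c`). [cite: Goldfeld2006, Prop. 10.3.2 (p. 292)] -/
theorem exists_eq_parabolic_mul_permGL_mul_upperUnitriangular {α : Type*} [LinearOrder α]
    {c : Fin n → α} (hc : Monotone c) (g : GL (Fin n) K) :
    ∃ (p : GL (Fin n) K) (σ : Equiv.Perm (Fin n)) (u : ↥(upperUnitriangular (Fin n) K)),
      p ∈ standardParabolicGL K c ∧ g = p * permGL σ * (u : GL (Fin n) K) := by
  obtain ⟨b, σ, u, hb, h⟩ := exists_eq_borel_mul_permGL_mul_upperUnitriangular g
  exact ⟨b, σ, u, borel_le_standardParabolicGL (R := K) hc hb, h⟩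

end Field

end Literature.NumberTheory.Automorphic
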